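import Summits.ResolutionOfSingularities.ResolutionOfSingularities.Theorems.HilbertSamuelEliminationSigmaMaxModificationsCorridor3SigmaMenuSurfaceStepNext
import Literature.AlgebraicGeometry.Resolution.BlowupSNC
import Literature.AlgebraicGeometry.Resolution.HasSNCStrictNormalCrossings
import HarnessLib

/-!
# [OURS · L1 W4.2] σ-LAYER PHASE B′ — `Corridor3SigmaSurfaceSncCarrier`: an SNC CARRIER LIST of the trace configuration survives every point blow-up AT A POINT OF THE
# CONFIGURATION, and then `ℓ` STAYS `0` — the bookkeeping of the cure-POINT step (self-crossing cure of RULING v3.14-43 (KN) (R-a); res-L1-w42-stub-1 DESIGN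
# CHECK 2 (b)/(c), 17:45Z) and of every other point step of the run at a point of an already-snc configuration
# (crux chain w42 `SigmaMaxModifications` stmt-ResolutionOfSingularities-18506 / conjunct `SigmaMaxModificationsCorridor3` stmt-ResolutionOfSingularities-19249;
# helper of res-L1-w42-stub-1 (gen 5), `--supports stmt-…-19249 --as helper`, counted 0)

HONEST FRAMING. OURS bookkeeping over Literature `HasSNCWith.hasSNC_transform` (`…BlowupSNC`, Kollár Def. 3.25 / BGMW Def. 3.1.3), `HasSNC.isStrictNormalCrossingsDivisor_biUnion_support`,
`stalkIdeal_vanishingIdeal_singleton`; res-type-067's `Boundary.next`/`divisorSet`/`hasSNC_map_comap_iff_of_isIso`/carrier glue; this seat's identification core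
(p548141/p550218) and `sncLength_eq_zero_iff` (p543674). NOTHING here is a statement of H. Hironaka's manuscript [Hironaka2017] nor of [CossartJannsenSaito2020]; no named
fact. AI-written; AI review is weaker than expert review.

THE POINT. `ℓ(E, D) = 0` says the configuration `S(E, D)` is snc AS A SET; the trace LIST need not be (`V(xy)` as one member). An **snc CARRIER** of a closed
set `S ⊆ D̃` is ANY list `Γs` of ideal sheaves with `HasSNC Γs` and `⋃ supp Γs = S` (e.g. the reduced components of `S`; NOT necessarily the trace list). Blowing
`D̃` up at a closed point `q ∈ S`: `Γs` has snc WITH the reduced point `𝓘(q)` (a point is cut out by ALL parameters), so the transformed list (strict transforms +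
exceptional curve) has snc (`hasSNC_transform`) and its divisor set is `ρ⁻¹ S` (`q ∈ S`) — an snc carrier of `ρ⁻¹ S`. Hence `ρ⁻¹ S` is snc and `ℓ` of the next
configuration is `0` again. (The ENTRY into the invariant — «an snc SET has an snc carrier, e.g. its component list» — is not typed here.)

## Contents (namespace `…Theorems.SigmaMaxModificationsCorridor3.Sigma`)

* `HasSNC.hasSNCWith_vanishingIdeal_singleton` — an snc list has snc with every reduced closed point.
* `HasSncCarrier S := ∃ Γs, HasSNC Γs ∧ Γs.divisorSet = S`; `HasSncCarrier.isStrictNormalCrossingsDivisor`; `HasSncCarrier.of_sncListOn` (READY traces are a carrier);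
  **`HasSncCarrier.next_point`** — for `q ∈ S` closed and the chosen blow-up `ρ = blowup.π 𝓘(q)` of the locally Noetherian `D̃`: `HasSncCarrier (ρ⁻¹ S)`;
  `HasSncCarrier.comap_iso` (transport along an isomorphism); `sncLength_eq_zero_of_hasSncCarrier` (`ℓ_T = 0` for any locus `T`).
* RUN LEVEL **`hasSncCarrier_next_of_point`** / **`surfaceSncLength_next_eq_zero_of_hasSncCarrier`**: if `S(E, D)` has an snc carrier and the step blows up the
  reduced point `ι_D q` of `W` with `q ∈ S(E, D)` (D irreducible), then `S(E.next C, surfaceNext (blowup.π C) C D)` has an snc carrier and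
  `ℓ(E.next C, D′) = 0`.

VACUITY SELF-CHECK. `HasSncCarrier` is inhabited by the trace list itself on READY surfaces (`of_sncListOn`) and by any snc list of components; the run-level
statements need `q ∈ S(E, D)` (cure points and F-75 points lie on the configuration) and `IsIrreducible D` (surface components of `X(ν)`).
-/

noncomputable section

set_option linter.dupNamespace false -- mandated namespace of this single-conjunct summit

open CategoryTheory AlgebraicGeometry TopologicalSpace IsLocalRing
open Summit.ResolutionOfSingularities.ResolutionOfSingularities.Theorems.CampaignW42
open Literature.AlgebraicGeometry.Resolution Literature.RingTheory.HilbertSamuel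

namespace Summit.ResolutionOfSingularities.ResolutionOfSingularities.Theorems.SigmaMaxModificationsCorridor3.Sigma

universe u

open Scheme.IdealSheafData

/-! ## An snc list has snc with every reduced closed point -/

section Point

variable {D : Scheme.{u}}

/-- **An snc list has simple normal crossings WITH every reduced closed point** (the point is cut out by ALL the parameters of the adapted regular system).
[cite: BierstoneGrigorievMilmanWlodarczyk2011, Def. 3.1.3 (2)] -/
theorem HasSNC.hasSNCWith_vanishingIdeal_singleton {Γs : List D.IdealSheafData} (hΓ : HasSNC Γs) {q : D} (hq : IsClosed ({q} : Set D)) :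
    HasSNCWith Γs (vanishingIdeal ⟨{q}, hq⟩) := by
  intro x
  obtain ⟨hreg, u, hu, hlab, -⟩ := hΓ x
  refine ⟨hreg, u, hu, hlab, fun hx => ⟨Set.univ, ?_⟩⟩
  rw [← SetLike.mem_coe, Scheme.IdealSheafData.coe_support_vanishingIdeal] at hx
  obtain rfl : x = q := hx
  rw [stalkIdeal_vanishingIdeal_singleton hq, Set.image_univ, hu]

end Point

/-! ## snc carriers -/

section Carrier

variable {D : Scheme.{u}}

/-- [OURS · L1 W4.2] **`S` HAS AN SNC CARRIER**: some list of ideal sheaves with simple normal crossings (Literature `HasSNC`) has divisor set exactly `S`. NOT a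
statement of the manuscript. [folklore] -/
def HasSncCarrier (S : Set D) : Prop :=
  ∃ Γs : Boundary D, HasSNC Γs ∧ Γs.divisorSet = S

/-- A set with an snc carrier is a strict normal crossings divisor. [folklore] -/
theorem HasSncCarrier.isStrictNormalCrossingsDivisor {S : Set D} (h : HasSncCarrier S) : IsStrictNormalCrossingsDivisor D S := by
  obtain ⟨Γs, hΓ, rfl⟩ := h
  exact hΓ.isStrictNormalCrossingsDivisor_biUnion_support

/-- READY traces are an snc carrier of their configuration. [folklore] -/
theorem HasSncCarrier.of_sncListOn {W : Scheme.{u}} {E : Boundary W} {ι : D ⟶ W} (h : E.SncListOn ι) : HasSncCarrier (E.restrictOff ι).divisorSet :=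
  ⟨E.restrictOff ι, h, rfl⟩

/-- `ℓ_T = 0` for a configuration with an snc carrier (any locus `T`). [folklore] -/
theorem sncLength_eq_zero_of_hasSncCarrier {S : Set D} (h : HasSncCarrier S) (T : Set D) : sncLength T S = 0 :=
  Nat.le_zero.mp (minLength_le (ExistsPointCompositionN.zero_iff.mpr (by
    have hpre : (𝟙 D : D ⟶ D) ⁻¹' S = S := Set.ext fun _ => Iff.rfl
    rw [resolvesToSnc_iff, hpre]; exact h.isStrictNormalCrossingsDivisor)))

/-- **AN SNC CARRIER SURVIVES THE POINT BLOW-UP AT A POINT OF THE CONFIGURATION**: for `q ∈ S` closed and `ρ = blowup.π I`, `I = 𝓘(q)` (locally Noetherian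
`D̃`), the transformed list (`Boundary.next`: strict transforms + exceptional curve) is an snc carrier of `ρ⁻¹ S`. [folklore] -/
theorem HasSncCarrier.next_point [IsLocallyNoetherian D] {S : Set D} (h : HasSncCarrier S) {q : D} (hq : IsClosed ({q} : Set D)) (hqS : q ∈ S)
    (I : D.IdealSheafData) (hI : I = vanishingIdeal ⟨{q}, hq⟩) : HasSncCarrier ((blowup.π I).base ⁻¹' S) := by
  subst hI
  obtain ⟨Γs, hΓ, rfl⟩ := h
  haveI : IsProper (blowup.π (vanishingIdeal (⟨{q}, hq⟩ : Closeds D))) := (blowup.isBlowup _).isProper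
  haveI : IsLocallyNoetherian (blowup (vanishingIdeal (⟨{q}, hq⟩ : Closeds D))) := LocallyOfFiniteType.isLocallyNoetherian (blowup.π _)
  refine ⟨Γs.next (vanishingIdeal ⟨{q}, hq⟩), (HasSNC.hasSNCWith_vanishingIdeal_singleton hΓ hq).hasSNC_transform (blowup.isBlowup _), ?_⟩
  rw [Boundary.divisorSet_next, Boundary.coe_support_comap, Scheme.IdealSheafData.coe_support_vanishingIdeal, Set.union_eq_left]
  -- the exceptional curve `ρ⁻¹ q` lies in `ρ⁻¹ S` because `q ∈ S`
  intro y hy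
  rw [Set.mem_preimage] at hy ⊢
  rw [show (blowup.π (vanishingIdeal (⟨{q}, hq⟩ : Closeds D))).base y = q from hy]
  exact hqS

/-- snc carriers transport along an isomorphism onto `D` (pull the list back). [folklore] -/
theorem HasSncCarrier.comap_iso [IsLocallyNoetherian D] {DZ : Scheme.{u}} (e : DZ ≅ D) {S : Set D} (h : HasSncCarrier S) :
    HasSncCarrier (e.hom.base ⁻¹' S) := by
  obtain ⟨Γs, hΓ, rfl⟩ := h
  refine ⟨Γs.restrict e.hom, (hasSNC_map_comap_iff_of_isIso Γs e.hom).mpr hΓ, ?_⟩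
  rw [Boundary.divisorSet_restrict]

end Carrier

/-! ## Run level: point steps at points of the configuration keep an snc carrier, hence `ℓ = 0` -/

section Run

variable {W : Scheme.{u}} [IsLocallyNoetherian W] {E : Boundary W} {D : Closeds W}

/-- **AN SNC CARRIER OF `S(E, D)` SURVIVES EVERY POINT STEP OF THE RUN AT A POINT OF `S(E, D)`** (D irreducible, `D̃ ≠ {q}`; centre = the reduced point `ι_D q`
of `W`): the next configuration `S(E.next C, surfaceNext (blowup.π C) C D)` has an snc carrier, and `ℓ(E.next C, D′) = 0`. [folklore] -/
theorem hasSncCarrier_next_of_point (hDirr : IsIrreducible (D : Set W)) {q : ↥(menuCentre D).subscheme} (hq : IsClosed ({q} : Set ↥(menuCentre D).subscheme))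
    (hqW : IsClosed ({(menuCentre D).subschemeι.base q} : Set W)) (hne : ({q} : Set ↥(menuCentre D).subscheme) ≠ Set.univ) (hqS : q ∈ surfaceTraceSet E D)
    (h : HasSncCarrier (surfaceTraceSet E D)) {C : W.IdealSheafData} (hC : C = vanishingIdeal ⟨{(menuCentre D).subschemeι.base q}, hqW⟩) :
    HasSncCarrier (surfaceTraceSet (E.next C) (surfaceNext (blowup.π C) C D)) ∧ surfaceSncLength (E.next C) (surfaceNext (blowup.π C) C D) = 0 := by
  subst hC
  set ι := (menuCentre D).subschemeι with hι
  haveI : IsProper (blowup.π (vanishingIdeal (⟨{ι.base q}, hqW⟩ : Closeds W))) := (blowup.isBlowup _).isProper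
  haveI : IsLocallyNoetherian (blowup (vanishingIdeal (⟨{ι.base q}, hqW⟩ : Closeds W))) := LocallyOfFiniteType.isLocallyNoetherian (blowup.π _)
  -- the centre restricted to the surface is the reduced point `q`
  have hCι : (vanishingIdeal (⟨{ι.base q}, hqW⟩ : Closeds W)).comap ι = vanishingIdeal ⟨{q}, hq⟩ :=
    comap_subschemeι_vanishingIdeal_singleton ι hq hqW
  have hCsupp : ((vanishingIdeal (⟨{ι.base q}, hqW⟩ : Closeds W)).support : Set W) = {ι.base q} := Scheme.IdealSheafData.coe_support_vanishingIdeal _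
  have hπ := blowup.isBlowup (vanishingIdeal (⟨{ι.base q}, hqW⟩ : Closeds W))
  have hρ := blowup.isBlowup ((vanishingIdeal (⟨{ι.base q}, hqW⟩ : Closeds W)).comap ι)
  have hρ' : IsBlowup (blowup.π ((vanishingIdeal (⟨{ι.base q}, hqW⟩ : Closeds W)).comap ι)) (vanishingIdeal ⟨{q}, hq⟩) := by
    rw [← hCι]; exact hρ
  set ρ := blowup.π ((vanishingIdeal (⟨{ι.base q}, hqW⟩ : Closeds W)).comap ι) with hρdef
  haveI : IsIntegral (menuCentre D).subscheme := isIntegral_subscheme_vanishingIdeal D hDirr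
  haveI : IsLocallyNoetherian (menuCentre D).subscheme := LocallyOfFiniteType.isLocallyNoetherian ι
  haveI : IsIntegral (blowup ((vanishingIdeal (⟨{ι.base q}, hqW⟩ : Closeds W)).comap ι)) := hρ'.isIntegral (vanishingIdeal_singleton_ne_bot hq hne)
  obtain ⟨e, he⟩ := exists_iso_menuCentre_surfaceNext hπ hρ
  -- identification of the next configuration with `ρ⁻¹ S` (point core of p548141)
  have hlift : ∀ y : ↥(menuCentre D).subscheme, y ≠ q → ∃ z, ρ.base z = y := by
    intro y hy
    refine hρ'.exists_eq_of_not_mem_support ?_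
    rw [Scheme.IdealSheafData.coe_support_vanishingIdeal]
    exact hy
  have hDd : Dense ({q}ᶜ : Set ↥(menuCentre D).subscheme) := by
    refine hq.isOpen_compl.dense ?_
    rw [Set.nonempty_compl]
    exact hne
  have hZd : Dense ((ρ.base ⁻¹' {q})ᶜ : Set ↥(blowup ((vanishingIdeal (⟨{ι.base q}, hqW⟩ : Closeds W)).comap ι))) := by
    refine (hq.preimage ρ.continuous).isOpen_compl.dense ?_
    haveI : Nonempty ↥(menuCentre D).subscheme := ⟨q⟩
    obtain ⟨y, hy⟩ := hDd.nonempty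
    obtain ⟨z, hz⟩ := hlift y hy
    exact ⟨z, fun h' => hy (by rw [Set.mem_preimage, hz, Set.mem_singleton_iff] at h'; exact h')⟩
  have hS : e.hom.base ⁻¹' surfaceTraceSet (E.next (vanishingIdeal ⟨{ι.base q}, hqW⟩))
      (surfaceNext (blowup.π (vanishingIdeal ⟨{ι.base q}, hqW⟩)) (vanishingIdeal ⟨{ι.base q}, hqW⟩) D) = ρ.base ⁻¹' surfaceTraceSet E D := by
    rw [preimage_surfaceTraceSet_surfaceNext hπ hρ e he, surfaceTraceSet_eq]
    exact divisorSet_restrictOff_eq_preimage (hπ.strictTransformHom_comp hρ) hCsupp hlift hDd hZd (isBoundaryTransform_next E _) hqS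
  -- carrier of `ρ⁻¹ S`, transported along `e`
  have hcar : HasSncCarrier (ρ.base ⁻¹' surfaceTraceSet E D) := h.next_point hq hqS _ hCι
  haveI : IsProper ρ := hρ.isProper
  haveI : IsLocallyNoetherian (blowup ((vanishingIdeal (⟨{ι.base q}, hqW⟩ : Closeds W)).comap ι)) := LocallyOfFiniteType.isLocallyNoetherian ρ
  haveI : IsLocallyNoetherian (menuCentre (surfaceNext (blowup.π (vanishingIdeal (⟨{ι.base q}, hqW⟩ : Closeds W)))
      (vanishingIdeal ⟨{ι.base q}, hqW⟩) D)).subscheme := LocallyOfFiniteType.isLocallyNoetherian (Scheme.IdealSheafData.subschemeι _)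
  have hcar' := hcar.comap_iso e.symm
  have hset : e.symm.hom.base ⁻¹' (ρ.base ⁻¹' surfaceTraceSet E D) = surfaceTraceSet (E.next (vanishingIdeal ⟨{ι.base q}, hqW⟩))
      (surfaceNext (blowup.π (vanishingIdeal ⟨{ι.base q}, hqW⟩)) (vanishingIdeal ⟨{ι.base q}, hqW⟩) D) := by
    rw [← hS]
    ext y
    simp only [Set.mem_preimage, Iso.symm_hom, IsPointBlowupCompositionN.hom_apply_inv_apply]
  rw [hset] at hcar'
  exact ⟨hcar', sncLength_eq_zero_of_hasSncCarrier hcar' _⟩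

end Run

end Summit.ResolutionOfSingularities.ResolutionOfSingularities.Theorems.SigmaMaxModificationsCorridor3.Sigma

end
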